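import Summits.ABC.IUTFork.LanaGoodPlace
import HarnessLib

/-!
# LANA §0.4 (e) / §3.7 vocabulary rows F-2628 / F-2631 / F-2632 — ∀-closures REFUTED, instances INHABITED

PROOF-ONLY companion (0 `def`, 0 `instance`, 0 notation) of the abc-iut cell, block F (seat abc-iut-f-130, gen 7; director-abc g4
ROW SUPPLY `ROWS-LF-0348.tsv` «decide the label»). It imports — never edits — the LANA-typing files of record `LanaGMData`
(`GMData.IsIsomorphicTo`, LANA §0.4 (e) "an object `A` is isomorphic to `B`"), `LanaStrips` (`GMData.IsHolomorphic`,
`GMData.IsMonoAnalytic`, §3.7; the Table-1 data `RefLocalDatum.Funit` / `Fhol` / `FunitMu`) and `LanaGoodPlace` (the reference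
local datum of record `padicRef p` at `ℚ_p`).

The three FACT-LIST rows are VOCABULARY predicates typed as free relations on `GMData` (resp. on `RefLocalDatum × GMData`); as
schemata their universal closures say «any two GM-data are isomorphic» / «every GM-datum is holomorphic / mono-analytic», which
is FALSE, and the kernel says so with one honest arithmetic input: in `O^▷_{ℚ̄_2}` the element `2` is NOT invertible
(`|2| = 1/2 < 1`, the cell's `p_mem_intMonoid`), so the Frobenius-like monoid `O^▷` of `F_v` is not a group, whereas those of
`F^{⊢×}_v` (`O^×`) and `F^{⊢×μ}_v` (`O^{×μ}`) are — and a multiplicative equivalence out of a group makes every element a unit.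

* F-2628 — `not_forall_isIsomorphicTo`: `F^{⊢×}_v ≇ F_v` at `v = 2`; `exists_isIsomorphicTo`: `IsIsomorphicTo.refl`.
* F-2631 — `not_forall_isHolomorphic`: `F^{⊢×}_v` is not holomorphic; `exists_isHolomorphic`: `RefLocalDatum.isHolomorphic_Fhol`.
* F-2632 — `not_forall_isMonoAnalytic`: `F_v` is not mono-analytic; `exists_isMonoAnalytic`: `RefLocalDatum.isMonoAnalytic_FunitMu`.

HONEST FRAMING: these certificates say only that the free-relation SCHEMATA are not theorems; they agree with (and do not go
beyond) the LANA report's own use of the words, take no side on the report, on [IUTchIII] Cor. 3.12 or on any author; a FACT row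
is an assumption label on OUR typed statement; typed ≠ proved. [cite: LANA2026Report, §0.4 (e) p. 8, §3.7 p. 20, §3.10 Table 1 p. 22]
-/

noncomputable section

namespace Summit.ABC

namespace IUTFork

namespace SchemaClosures

/-- An element of `O^▷` of valuation `< 1` is not a unit of the monoid `O^▷` (its inverse would have valuation `> 1`).
[cite: LANA2026Report, §0.4 (b) p. 8] -/
private theorem not_isUnit_intMonoid_of_lt_one {K : Type} [Field K] {Γ₀ : Type} [LinearOrderedCommGroupWithZero Γ₀]
    (w : Valuation K Γ₀) (a : intMonoid w) (ha : w (a : K) < 1) : ¬ IsUnit a := by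
  intro hu
  obtain ⟨b, hb⟩ := hu.exists_right_inv
  have hab : w (a : K) * w (b : K) = 1 := by
    rw [← map_mul, ← Submonoid.coe_mul, hb, Submonoid.coe_one, map_one]
  have hle : w (a : K) * w (b : K) ≤ w (a : K) * 1 := by gcongr; exact b.2.2
  rw [hab, mul_one] at hle
  exact absurd ha (not_lt.mpr hle)

/-- No multiplicative equivalence maps a GROUP onto the monoid `O^▷_{ℚ̄_p}`: the image of the preimage of `p` would make `p`
a unit, but `|p| < 1`. [cite: LANA2026Report, §3.6 p. 19] -/
private theorem isEmpty_mulEquiv_group_intMonoid (p : ℕ) [Fact p.Prime] (A : Type) [Group A] :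
    IsEmpty (A ≃* intMonoid (padicVal p)) := by
  refine ⟨fun e => ?_⟩
  have hp1 : padicVal p (p : PadicAlgCl p) < 1 := by
    rw [padicVal, PadicAlgCl.valuation_p, one_div]
    exact inv_lt_one_of_one_lt₀ (by exact_mod_cast (Fact.out : p.Prime).one_lt)
  refine not_isUnit_intMonoid_of_lt_one (padicVal p) ⟨(p : PadicAlgCl p), p_mem_intMonoid p⟩ hp1 ?_
  have h := (Group.isUnit (e.symm ⟨(p : PadicAlgCl p), p_mem_intMonoid p⟩)).map e
  rwa [MulEquiv.apply_symm_apply] at h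

/-- `F^{⊢×}_v ≇ F_v` at `ℚ_p`: their Frobenius-like portions are the GROUP `O^×` and the non-group monoid `O^▷`.
[cite: LANA2026Report, §3.10 Table 1 p. 22] -/
private theorem not_isIsomorphicTo_Funit_Fhol (p : ℕ) [Fact p.Prime] :
    ¬ (padicRef p).Funit.IsIsomorphicTo (padicRef p).Fhol := by
  rintro ⟨⟨φ⟩⟩
  exact (isEmpty_mulEquiv_group_intMonoid p (unitGrp (padicVal p))).false φ.eM.toMulEquiv

/-- `F_v` is not a copy of `F^{⊢×μ}_v` at `ℚ_p`: `O^{×μ}` is a group, `O^▷` is not. [cite: LANA2026Report, §3.10 Table 1 p. 22] -/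
private theorem not_isIsomorphicTo_Fhol_FunitMu (p : ℕ) [Fact p.Prime] :
    ¬ (padicRef p).Fhol.IsIsomorphicTo (padicRef p).FunitMu.toGMData := by
  rintro ⟨⟨φ⟩⟩
  exact (isEmpty_mulEquiv_group_intMonoid p (UnitsModTorsion (padicVal p))).false φ.eM.toMulEquiv.symm

/-! ## F-2628 `GMData.IsIsomorphicTo` (LANA §0.4 (e)) -/

/-- **F-2628, ∀-closure REFUTED**: not every two GM-data are isomorphic — `F^{⊢×}_v ≇ F_v` at `v = 2`.
[cite: LANA2026Report, §0.4 (e) p. 8] -/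
theorem not_forall_isIsomorphicTo : ¬ ∀ X Y : GMData, X.IsIsomorphicTo Y :=
  fun h => not_isIsomorphicTo_Funit_Fhol 2 (h _ _)

/-- **F-2628, INHABITED**: every GM-datum is isomorphic to itself (`IsIsomorphicTo.refl`). [cite: LANA2026Report, §0.4 (e) p. 8] -/
theorem exists_isIsomorphicTo : ∃ X Y : GMData, X.IsIsomorphicTo Y :=
  ⟨(padicRef 2).Fhol, (padicRef 2).Fhol, GMData.IsIsomorphicTo.refl _⟩

/-! ## F-2631 `GMData.IsHolomorphic` (LANA §3.7) -/

/-- **F-2631, ∀-closure REFUTED**: the étale-unit datum `F^{⊢×}_v` at `v = 2` is not holomorphic (not a copy of `F_v`).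
[cite: LANA2026Report, §3.7 p. 20] -/
theorem not_forall_isHolomorphic : ¬ ∀ (L : RefLocalDatum) (X : GMData), GMData.IsHolomorphic L X :=
  fun h => not_isIsomorphicTo_Funit_Fhol 2 (h (padicRef 2) (padicRef 2).Funit).isCopy

/-- **F-2631, INHABITED**: `F_v` is holomorphic (`RefLocalDatum.isHolomorphic_Fhol`). [cite: LANA2026Report, §3.7 p. 20] -/
theorem exists_isHolomorphic : ∃ (L : RefLocalDatum) (X : GMData), GMData.IsHolomorphic L X :=
  ⟨padicRef 2, (padicRef 2).Fhol, (padicRef 2).isHolomorphic_Fhol⟩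

/-! ## F-2632 `GMData.IsMonoAnalytic` (LANA §3.7) -/

/-- **F-2632, ∀-closure REFUTED**: the holomorphic datum `F_v` at `v = 2` is not mono-analytic (not a copy of `F^{⊢×μ}_v`).
[cite: LANA2026Report, §3.7 p. 20] -/
theorem not_forall_isMonoAnalytic : ¬ ∀ (L : RefLocalDatum) (X : GMData), GMData.IsMonoAnalytic L X :=
  fun h => not_isIsomorphicTo_Fhol_FunitMu 2 (h (padicRef 2) (padicRef 2).Fhol).isCopy

/-- **F-2632, INHABITED**: `F^{⊢×μ}_v` is mono-analytic (`RefLocalDatum.isMonoAnalytic_FunitMu`). [cite: LANA2026Report, §3.7 p. 20] -/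
theorem exists_isMonoAnalytic : ∃ (L : RefLocalDatum) (X : GMData), GMData.IsMonoAnalytic L X :=
  ⟨padicRef 2, (padicRef 2).FunitMu.toGMData, (padicRef 2).isMonoAnalytic_FunitMu⟩

end SchemaClosures

end IUTFork

end Summit.ABC

end
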